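import Summits.RiemannHypothesis.RiemannHypothesis.Theorems.ScrewManifestCertResidual

/-!
# Route `IntegerScrew` — a two-sided bracket of `C = ζ(2,¼)` of ANY length `K` (for the census kernel import)

The manifest-certificate checks need `S_M = T(C)`, `C = ζ(2,¼) = Σ_k (k+¼)^{-2}`, with a TWO-sided bracket
`c_lo ≤ C ≤ c_hi`; the tree's `RungCert.cLoQ` / `Manifest.cHiQ` are the `K = 300`-term instances (width `1.1·10⁻⁵`,
which costs `2.8·10⁻⁶` per off-diagonal entry — 72 % of the row margin of the census cell at `M = 48` and more than
the margin at `M = 112`; HOME/sos/CENSUS-KERNEL-IMPORT-engA.md §3).  This file states the same bracket for ANY number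
of terms `K`: `cLoK K = (Σ_{k<K})⁻ + 1/(K+¼) ≤ C ≤ (Σ_{k<K})⁺ + 1/(K−¾) = cHiK K` (`cLoK_le_lerchC`, `lerchC_le_cHiK`;
width `≈ 1/K²`, e.g. `10⁻⁸` at `K = 10⁴`), the partial sums being the engine's `RungCert.cPartial K` (evaluated once
per instance file as a literal).  Proofs = the tree's `partial_add_inv_le_lerchC` and `sum_Ico_quarter_sq_le` with
`K` free.  RH-free; nothing here bears on the truth of RH.
-/

set_option linter.dupNamespace false
set_option autoImplicit false

namespace Summit.RiemannHypothesis.RiemannHypothesis.Theorems.IntegerScrew.Manifest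

open Literature.Analysis.ValidatedNumerics Literature.Analysis.ValidatedNumerics.Numerics Finset

/-- Lower bracket of `ζ(2,¼)` from `K` terms: `(Σ_{k<K}(k+¼)^{-2})⁻ + 4/(4K+1)`. -/
def cLoK (K : ℕ) : ℚ := ((RungCert.cPartial K).lo : ℚ) / SC + 4 / (4 * K + 1)

/-- Upper bracket of `ζ(2,¼)` from `K` terms: `(Σ_{k<K}(k+¼)^{-2})⁺ + 4/(4K−3)`. -/
def cHiK (K : ℕ) : ℚ := ((RungCert.cPartial K).hi : ℚ) / SC + 4 / (4 * K - 3)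

/-- **`cLoK K ≤ C`.** -/
theorem cLoK_le_lerchC (K : ℕ) : ((cLoK K : ℚ) : ℝ) ≤ RungCert.lerchC := by
  have h1 := (RungCert.mem_cPartial K).1
  have h2 := RungCert.partial_add_inv_le_lerchC K
  have hS := SC_pos
  have h3 : (((RungCert.cPartial K).lo : ℤ) : ℝ) / SC ≤ ∑ k ∈ range K, 1 / ((k : ℝ) + 1 / 4) ^ 2 := by
    rw [div_le_iff₀ hS]; exact h1
  have h4 : ((cLoK K : ℚ) : ℝ) = (((RungCert.cPartial K).lo : ℤ) : ℝ) / SC + 4 / (4 * (K : ℝ) + 1) := by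
    unfold cLoK; push_cast; ring
  have h5 : (4 : ℝ) / (4 * (K : ℝ) + 1) = 1 / ((K : ℝ) + 1 / 4) := by
    rw [div_eq_div_iff (by positivity) (by positivity)]; ring
  rw [h4, h5]
  unfold RungCert.lerchC
  linarith

/-- **`C ≤ cHiK K`** (`1 ≤ K`). -/
theorem lerchC_le_cHiK {K : ℕ} (hK : 1 ≤ K) : RungCert.lerchC ≤ ((cHiK K : ℚ) : ℝ) := by
  have hS : (0 : ℝ) < SC := SC_pos
  have h1 := (RungCert.mem_cPartial K).2
  have hpart : ∑ k ∈ range K, 1 / ((k : ℝ) + 1 / 4) ^ 2 ≤ (((RungCert.cPartial K).hi : ℤ) : ℝ) / SC := by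
    rw [le_div_iff₀ hS]; exact h1
  have hK1 : (1 : ℝ) ≤ K := by exact_mod_cast hK
  have hKpos : (0 : ℝ) < (K : ℝ) - 3 / 4 := by linarith
  have htail : ∀ n, ∑ i ∈ range n, 1 / ((i : ℝ) + 1 / 4) ^ 2 ≤
      ∑ k ∈ range K, 1 / ((k : ℝ) + 1 / 4) ^ 2 + 1 / ((K : ℝ) - 3 / 4) := by
    intro n
    rcases le_or_gt n K with hn | hn
    · have hsub : ∑ i ∈ range n, 1 / ((i : ℝ) + 1 / 4) ^ 2 ≤ ∑ k ∈ range K, 1 / ((k : ℝ) + 1 / 4) ^ 2 :=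
        Finset.sum_le_sum_of_subset_of_nonneg (Finset.range_mono hn) fun k _ _ =>
          one_div_nonneg.2 (sq_nonneg _)
      have hpos : (0 : ℝ) < 1 / ((K : ℝ) - 3 / 4) := one_div_pos.2 hKpos
      linarith
    · rw [range_eq_Ico, ← Finset.sum_Ico_consecutive _ (Nat.zero_le K) hn.le, ← range_eq_Ico]
      have h2 := sum_Ico_quarter_sq_le (K := K) hK n hn.le
      have hn' : (K : ℝ) < n := by exact_mod_cast hn
      have hpos : (0 : ℝ) < 1 / ((n : ℝ) - 3 / 4) := by
        apply div_pos one_pos; linarith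
      linarith
  have hsum := Real.tsum_le_of_sum_range_le (f := fun k : ℕ => 1 / ((k : ℝ) + 1 / 4) ^ 2)
    (fun n => one_div_nonneg.2 (sq_nonneg _)) htail
  have h5 : (((4 / (4 * K - 3) : ℚ)) : ℝ) = 1 / ((K : ℝ) - 3 / 4) := by
    have hK3 : (3 : ℕ) ≤ 4 * K := by omega
    push_cast [Nat.cast_sub hK3]
    rw [div_eq_div_iff (by linarith) hKpos.ne']; ring
  unfold RungCert.lerchC
  unfold cHiK
  push_cast at h5 ⊢
  rw [h5]
  linarith

end Summit.RiemannHypothesis.RiemannHypothesis.Theorems.IntegerScrew.Manifest
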